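import Mathlib
import Summits.Ventures.PercRepro2.AsymPins

/-!
# The blue-only pin IS the (AS3) core: the equivalence, and the monotone route (INC-BP)
(seat mine-b, cell pub-perc-repro2; conjectures/MINE-B.md §14)

AsymPins.lean showed that (AS3) for the nested pair `(A (insert q O ∪ ·), A (O ∪ ·))` gives the
blue-only-pin STEP(0,2) of `A` at `(O, Y, q)`.  Here the converse: every (AS3) instance with `A ⊇ B`
on a cube `U` is a blue-pin instance of ONE clutter — `bpEvent A B q`, the event «contains a `B`-member,
or contains `q` together with an `A`-member» (the clutter `min B ∪ {K ∪ q : K ∈ min A, K ∉ B}`).  For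
`γ ⊆ U ∌ q`: its packings inside `U` are the `B`-packings (`kDisj_bpEvent_iff`), `γ ∪ q` carries it iff
`γ ∈ A` (`bpEvent_insert_iff`), and two disjoint members inside `γ ∪ q` are a disjoint occurrence of
`(A, B)` at `γ` (`kDisj_two_bpEvent_insert_iff`).  Hence

* `AS3_iff_bluePin` — **`AS3 U A B ↔` (BP) for `bpEvent A B q` at `(∅, U, q)`**, for nested increasing
  `B ⊆ A` and any `q ∉ U`;
* `bluePinStep_iff_AS3_nested` — «every clutter tolerates one blue-only pin at the row (0,2)» is
  equivalent to «(AS3) holds for every nested pair `B ⊆ A` (first event bigger) on every cube with a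
  spare element».  CAUTION: the i = 0 row of STEP needs (AS3) on the pairs `(pack ≥ j−1, pack ≥ 1)`,
  whose first event is the SMALLER one (`stepH_zero_of_AS3`); that regime is not covered here;
* `bluePin_of_incBluePin` — the monotone route: if the blue-pinned slack never decreases when an
  element joins the split set (`IncBluePin`, the row (INC-BP), census-true on every clutter on ≤ 6
  elements with every pin set), then (BP) holds on every pattern (the split set `∅` has slack `≥ 0`) —
  the exact analogue of `absH_step_of_splitMono` / `reimerSlack_nonneg_of_incReimer`.
-/

open Finset

namespace Summit.Ventures.PercRepro2

namespace StepZero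

open ReimerCube

variable {E : Type*} [DecidableEq E]

open Classical

/-! ## The clutter of a nested pair -/

/-- the event «`X` contains a `B`-member, or `X ∋ q` and `X \ q` contains an `A`-member» — the
up-set of the clutter `min B ∪ {K ∪ q : K ∈ min A, K ∉ B}` -/
def bpEvent (A B : Finset E → Prop) (q : E) (X : Finset E) : Prop :=
  B (X.erase q) ∨ (q ∈ X ∧ A (X.erase q))

/-- the clutter event of a nested pair is increasing -/
lemma incr_bpEvent {A B : Finset E → Prop} (hA : Incr A) (hB : Incr B) (q : E) :
    Incr (bpEvent A B q) := by
  intro S T hST h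
  rcases h with h | ⟨hq, h⟩
  · exact Or.inl (hB (Finset.erase_subset_erase q hST) h)
  · exact Or.inr ⟨hST hq, hA (Finset.erase_subset_erase q hST) h⟩

/-- on sets avoiding `q` the event is `B` -/
lemma bpEvent_of_not_mem {A B : Finset E → Prop} (q : E) {X : Finset E} (hq : q ∉ X) :
    bpEvent A B q X ↔ B X := by
  unfold bpEvent
  rw [Finset.erase_eq_of_notMem hq]
  constructor
  · rintro (h | ⟨h, -⟩)
    · exact h
    · exact absurd h hq
  · exact fun h => Or.inl h

/-- on `insert q X` with `q ∉ X` the event is `A` (for `B ⊆ A`) -/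
lemma bpEvent_insert_iff {A B : Finset E → Prop} (hBA : ∀ X, B X → A X) (q : E) {X : Finset E}
    (hq : q ∉ X) : bpEvent A B q (insert q X) ↔ A X := by
  unfold bpEvent
  rw [Finset.erase_insert hq]
  constructor
  · rintro (h | ⟨-, h⟩)
    · exact hBA X h
    · exact h
  · exact fun h => Or.inr ⟨Finset.mem_insert_self q X, h⟩

/-- an up-witness of `bpEvent` avoiding `q` is an up-witness of `B` -/
lemma bpEvent_witness_iff {A B : Finset E → Prop} (hB : Incr B) (q : E) {K : Finset E} (hq : q ∉ K) :
    (∀ T, K ⊆ T → bpEvent A B q T) ↔ (∀ T, K ⊆ T → B T) := by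
  constructor
  · intro h T hKT
    have h1 := h T hKT
    unfold bpEvent at h1
    rcases h1 with h1 | ⟨hqT, h1⟩
    · exact hB (Finset.erase_subset q T) h1
    · -- `K ⊆ T.erase q`, and `T.erase q ∪ {q}`… use the witness at `T.erase q`
      have hKT' : K ⊆ T.erase q := by
        intro x hx
        exact Finset.mem_erase.mpr ⟨fun hxq => hq (hxq ▸ hx), hKT hx⟩
      have h2 := h (T.erase q) hKT'
      unfold bpEvent at h2
      rw [Finset.erase_idem] at h2
      rcases h2 with h2 | ⟨h2, -⟩
      · exact hB (Finset.erase_subset q _) h2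
      · exact absurd h2 (Finset.notMem_erase q T)
  · intro h T hKT
    exact Or.inl (h (T.erase q) (by
      intro x hx
      exact Finset.mem_erase.mpr ⟨fun hxq => hq (hxq ▸ hx), hKT hx⟩))

/-- the packings of `bpEvent` inside a set avoiding `q` are the packings of `B` -/
lemma kDisj_bpEvent_iff {A B : Finset E → Prop} (hB : Incr B) (q : E) :
    ∀ (k : ℕ) {X : Finset E}, q ∉ X → (kDisj (bpEvent A B q) k X ↔ kDisj B k X)
  | 0, X, _ => Iff.rfl
  | k + 1, X, hqX => by
    constructor
    · rintro ⟨K, L, hK, hL, hKL, hAK, hBL⟩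
      have hqK : q ∉ K := fun h => hqX (hK h)
      refine ⟨K, L, hK, hL, hKL, (bpEvent_witness_iff hB q hqK).mp hAK, ?_⟩
      intro T hLT
      have hqL : q ∉ L := fun h => hqX (hL h)
      -- `kDisj (bpEvent) k` on `T` for all `T ⊇ L`: use the witness at `T.erase q` (avoids `q`)
      have hT' : L ⊆ T.erase q := by
        intro x hx
        exact Finset.mem_erase.mpr ⟨fun hxq => hqL (hxq ▸ hx), hLT hx⟩
      have := hBL (T.erase q) hT'
      rw [kDisj_bpEvent_iff hB q k (Finset.notMem_erase q T)] at this
      exact incr_kDisj B k (Finset.erase_subset q T) this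
    · rintro ⟨K, L, hK, hL, hKL, hBK, hBL⟩
      have hqK : q ∉ K := fun h => hqX (hK h)
      have hqL : q ∉ L := fun h => hqX (hL h)
      refine ⟨K, L, hK, hL, hKL, (bpEvent_witness_iff hB q hqK).mpr hBK, ?_⟩
      intro T hLT
      have hT' : L ⊆ T.erase q := by
        intro x hx
        exact Finset.mem_erase.mpr ⟨fun hxq => hqL (hxq ▸ hx), hLT hx⟩
      have := hBL (T.erase q) hT'
      rw [← kDisj_bpEvent_iff hB q k (Finset.notMem_erase q T)] at this
      exact incr_kDisj (bpEvent A B q) k (Finset.erase_subset q T) this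

/-- an up-witness of `bpEvent` through `q` is, after removing `q`, an up-witness of `A` -/
lemma aWitness_of_bpEvent_witness {A B : Finset E → Prop} (hA : Incr A) (hBA : ∀ X, B X → A X) (q : E)
    {K : Finset E} (hEK : ∀ T, K ⊆ T → bpEvent A B q T) :
    ∀ T, K.erase q ⊆ T → A T := by
  intro T hT
  have hKT : K ⊆ insert q T := by
    intro x hx
    by_cases hxq : x = q
    · exact hxq ▸ Finset.mem_insert_self q T
    · exact Finset.mem_insert_of_mem (hT (Finset.mem_erase.mpr ⟨hxq, hx⟩))
  have h1 := hEK (insert q T) hKT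
  unfold bpEvent at h1
  rw [Finset.erase_insert_eq_erase] at h1
  have h2 : A (T.erase q) := by
    rcases h1 with h1 | ⟨-, h1⟩
    · exact hBA _ h1
    · exact h1
  exact hA (Finset.erase_subset q T) h2

/-- two disjoint members of `bpEvent` inside `insert q γ` (`q ∉ γ`) are exactly a disjoint occurrence of
`(A, B)` at `γ` -/
lemma kDisj_two_bpEvent_insert_iff {A B : Finset E → Prop} (hA : Incr A) (hB : Incr B)
    (hBA : ∀ X, B X → A X) (q : E) {γ : Finset E} (hq : q ∉ γ) :
    kDisj (bpEvent A B q) 2 (insert q γ) ↔ DOcc A B γ := by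
  have hE : Incr (bpEvent A B q) := incr_bpEvent hA hB q
  -- a subset of `insert q γ` avoiding `q` lies in `γ`
  have sub : ∀ {X : Finset E}, X ⊆ insert q γ → q ∉ X → X ⊆ γ := by
    intro X hX hqX x hx
    rcases Finset.mem_insert.mp (hX hx) with h | h
    · exact absurd (h ▸ hx) hqX
    · exact h
  have subE : ∀ {X : Finset E}, X ⊆ insert q γ → X.erase q ⊆ γ := by
    intro X hX x hx
    rcases Finset.mem_insert.mp (hX (Finset.mem_of_mem_erase hx)) with h | h
    · exact absurd h (Finset.ne_of_mem_erase hx)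
    · exact h
  constructor
  · rintro ⟨K, L, hK, hL, hKL, hEK, hEL⟩
    have hEL' : ∀ T, L ⊆ T → bpEvent A B q T := fun T hT => (kDisj_one_iff hE T).mp (hEL T hT)
    by_cases hqK : q ∈ K
    · have hqL : q ∉ L := fun h => Finset.disjoint_left.mp hKL hqK h
      exact ⟨K.erase q, L, subE hK, sub hL hqL,
        Finset.disjoint_of_subset_left (Finset.erase_subset q K) hKL,
        aWitness_of_bpEvent_witness hA hBA q hEK, (bpEvent_witness_iff hB q hqL).mp hEL'⟩
    · by_cases hqL : q ∈ L
      · exact ⟨L.erase q, K, subE hL, sub hK hqK,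
          Finset.disjoint_of_subset_left (Finset.erase_subset q L) hKL.symm,
          aWitness_of_bpEvent_witness hA hBA q hEL', (bpEvent_witness_iff hB q hqK).mp hEK⟩
      · exact ⟨K, L, sub hK hqK, sub hL hqL, hKL,
          fun T hT => hBA T ((bpEvent_witness_iff hB q hqK).mp hEK T hT),
          (bpEvent_witness_iff hB q hqL).mp hEL'⟩
  · rintro ⟨K, L, hK, hL, hKL, hAK, hBL⟩
    have hqK : q ∉ K := fun h => hq (hK h)
    have hqL : q ∉ L := fun h => hq (hL h)
    refine ⟨insert q K, L, Finset.insert_subset_insert q hK, hL.trans (Finset.subset_insert q γ), ?_,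
      ?_, ?_⟩
    · rw [Finset.disjoint_insert_left]; exact ⟨hqL, hKL⟩
    · intro T hT
      refine Or.inr ⟨hT (Finset.mem_insert_self q K), hAK _ ?_⟩
      intro x hx
      exact Finset.mem_erase.mpr ⟨fun hxq => hqK (hxq ▸ hx), hT (Finset.mem_insert_of_mem hx)⟩
    · intro T hT
      rw [kDisj_one_iff hE]
      refine Or.inl (hBL _ ?_)
      intro x hx
      exact Finset.mem_erase.mpr ⟨fun hxq => hqL (hxq ▸ hx), hT hx⟩

/-! ## The equivalence -/

omit [DecidableEq E] in
/-- two disjoint members, as a disjoint occurrence of the event with itself -/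
lemma kDisj_two_iff' {B : Finset E → Prop} (hB : Incr B) (X : Finset E) :
    kDisj B 2 X ↔ DOcc B B X := by
  show DOcc B (kDisj B 1) X ↔ DOcc B B X
  constructor
  · exact fun h => DOcc.mono_right (fun T hT => (kDisj_one_iff hB T).mp hT) h
  · exact fun h => DOcc.mono_right (fun T hT => (kDisj_one_iff hB T).mpr hT) h

/-- **`AS3 U A B` is (BP) for the clutter `bpEvent A B q` at `(∅, U, q)`** (nested increasing `B ⊆ A`,
`q ∉ U`). -/
theorem AS3_iff_bluePin {A B : Finset E → Prop} (hA : Incr A) (hB : Incr B) (hBA : ∀ X, B X → A X)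
    (U : Finset E) (q : E) (hqU : q ∉ U) :
    AS3 U A B ↔
      absHA (bpEvent A B q) ∅ (insert q ∅) U 0 2 ≤ absHA (bpEvent A B q) ∅ (insert q ∅) U 1 1 := by
  have hE : Incr (bpEvent A B q) := incr_bpEvent hA hB q
  unfold AS3 absHA
  have e1 : U.powerset.filter (fun γ => pinK (bpEvent A B q) ∅ 0 (U \ γ) ∧
      ¬ pinK (bpEvent A B q) ∅ (0 + 1) (U \ γ) ∧ pinK (bpEvent A B q) (insert q ∅) 2 γ)
      = U.powerset.filter (fun γ => DOcc A B γ ∧ ¬ B (U \ γ)) := by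
    apply Finset.filter_congr
    intro γ hγ
    rw [Finset.mem_powerset] at hγ
    have hqγ : q ∉ γ := fun h => hqU (hγ h)
    have hqρ : q ∉ U \ γ := fun h => hqU (Finset.mem_sdiff.mp h).1
    unfold pinK
    rw [Finset.empty_union, Finset.insert_union, Finset.empty_union,
      kDisj_one_iff hE, bpEvent_of_not_mem q hqρ, kDisj_two_bpEvent_insert_iff hA hB hBA q hqγ]
    constructor
    · rintro ⟨-, h1, h2⟩; exact ⟨h2, h1⟩
    · rintro ⟨h2, h1⟩; exact ⟨trivial, h1, h2⟩
  have e2 : U.powerset.filter (fun γ => pinK (bpEvent A B q) ∅ 1 (U \ γ) ∧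
      ¬ pinK (bpEvent A B q) ∅ (1 + 1) (U \ γ) ∧ pinK (bpEvent A B q) (insert q ∅) 1 γ)
      = U.powerset.filter (fun γ => A γ ∧ B (U \ γ) ∧ ¬ DOcc B B (U \ γ)) := by
    apply Finset.filter_congr
    intro γ hγ
    rw [Finset.mem_powerset] at hγ
    have hqγ : q ∉ γ := fun h => hqU (hγ h)
    have hqρ : q ∉ U \ γ := fun h => hqU (Finset.mem_sdiff.mp h).1
    unfold pinK
    rw [Finset.empty_union, Finset.insert_union, Finset.empty_union,
      kDisj_one_iff hE, bpEvent_of_not_mem q hqρ, kDisj_one_iff hE, bpEvent_insert_iff hBA q hqγ,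
      kDisj_bpEvent_iff hB q 2 hqρ, kDisj_two_iff' hB]
    constructor
    · rintro ⟨h1, h2, h3⟩; exact ⟨h3, h1, h2⟩
    · rintro ⟨h3, h1, h2⟩; exact ⟨h1, h2, h3⟩
  rw [e1, e2]

/-- **(BP) for every clutter ⟺ (AS3) for every nested pair `B ⊆ A` (first event bigger) on every cube
with a spare element.** -/
theorem bluePinStep_iff_AS3_nested :
    (∀ A : Finset E → Prop, Incr A → BluePinStep A) ↔
      (∀ A B : Finset E → Prop, Incr A → Incr B → (∀ X, B X → A X) →
        ∀ (U : Finset E) (q : E), q ∉ U → AS3 U A B) := by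
  constructor
  · intro h A B hA hB hBA U q hqU
    rw [AS3_iff_bluePin hA hB hBA U q hqU]
    exact h (bpEvent A B q) (incr_bpEvent hA hB q) ∅ U q (Finset.notMem_empty q) hqU
  · intro h A hA O Y q hqO hqY
    refine absHA_bluePin_zero_two_le_of_AS3 hA O Y q (h _ _ ?_ ?_ ?_ Y q hqY)
    · exact fun _ _ hST hS => hA (Finset.union_subset_union_right hST) hS
    · exact fun _ _ hST hS => hA (Finset.union_subset_union_right hST) hS
    · exact fun X hX => hA (Finset.union_subset_union_left (Finset.subset_insert q O)) hX

/-! ## The monotone route: (INC-BP) ⟹ (BP) -/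

/-- **(INC-BP)**: the blue-only-pinned STEP(0,2) slack never decreases when an element joins the split
set (census-true on every clutter on ≤ 6 elements with every pin set, MINE-B.md §14) -/
def IncBluePin (A : Finset E → Prop) : Prop :=
  ∀ (O Y : Finset E) (q y : E), q ∉ O → q ∉ Y → y ∉ O → y ∉ Y → y ≠ q →
    slackA A O (insert q O) Y 0 2 ≤ slackA A O (insert q O) (insert y Y) 0 2

/-- with an empty split set the blue-pinned count `H(0,2)` vanishes: two disjoint members of
`insert q O` contain one inside `O` -/
lemma absHA_bluePin_empty_zero_two {A : Finset E → Prop} (hA : Incr A) (O : Finset E) (q : E) :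
    absHA A O (insert q O) ∅ 0 2 = 0 := by
  unfold absHA
  rw [Finset.card_eq_zero, Finset.filter_eq_empty_iff]
  intro γ hγ
  rw [Finset.mem_powerset, Finset.subset_empty] at hγ
  subst hγ
  rintro ⟨-, h1, h2⟩
  apply h1
  rw [pinK_one_iff hA]
  obtain ⟨K, L, hK, -, -, hAK, -⟩ := dOcc_pinned_of_pinK_two_insert hA O q h2
  rw [Finset.subset_empty] at hK
  subst hK
  exact hAK ∅ le_rfl

/-- **(INC-BP) implies (BP) on every pattern with disjoint pins and split set**, by induction on the
split set (the base case is `absHA_bluePin_empty_zero_two`). -/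
theorem bluePin_of_incBluePin {A : Finset E → Prop} (hA : Incr A) (h : IncBluePin A)
    (O Y : Finset E) (hOY : Disjoint O Y) (q : E) (hqO : q ∉ O) (hqY : q ∉ Y) :
    absHA A O (insert q O) Y 0 2 ≤ absHA A O (insert q O) Y 1 1 := by
  have key : ∀ Y : Finset E, Disjoint O Y → q ∉ Y → 0 ≤ slackA A O (insert q O) Y 0 2 := by
    intro Y
    induction Y using Finset.induction_on with
    | empty =>
      intro _ _
      unfold slackA
      rw [absHA_bluePin_empty_zero_two hA O q]
      simp
    | insert y Y hy ih =>
      intro hd hqY'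
      have hyO : y ∉ O := fun h' => Finset.disjoint_left.mp hd h' (Finset.mem_insert_self y Y)
      have hd' : Disjoint O Y := Finset.disjoint_of_subset_right (Finset.subset_insert y Y) hd
      have hqY : q ∉ Y := fun h' => hqY' (Finset.mem_insert_of_mem h')
      have hyq : y ≠ q := fun h' => hqY' (h' ▸ Finset.mem_insert_self y Y)
      exact le_trans (ih hd' hqY) (h O Y q y hqO hqY hyO hy hyq)
  have := key Y hOY hqY
  unfold slackA at this
  have e : absHA A O (insert q O) Y (0 + 1) (2 - 1) = absHA A O (insert q O) Y 1 1 := rfl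
  rw [e] at this
  omega

end StepZero

end Summit.Ventures.PercRepro2
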